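import Summits.CriticalPhenomena.PercolationContinuityZ3.Theorems.Transplant.PlanarSkeletonFrmQuasiDefs
import Summits.CriticalPhenomena.PercolationContinuityZ3.Theorems.Transplant.SkelFrmQuasi1ChoiceDefs
import Summits.CriticalPhenomena.PercolationContinuityZ3.Theorems.Transplant.SkelFrm1ChoiceDefs
import Summits.CriticalPhenomena.PercolationContinuityZ3.Theorems.Transplant.SkelFrmQuasiBParamsLOA
import Summits.CriticalPhenomena.PercolationContinuityZ3.Theorems.Transplant.SkelFrmBParamsLOA
import Summits.CriticalPhenomena.PercolationContinuityZ3.Theorems.Transplant.SkelFrmQuasi1ParamsLBL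
import Summits.CriticalPhenomena.PercolationContinuityZ3.Theorems.Transplant.SkelFrm1ParamsLBL
import Summits.CriticalPhenomena.PercolationContinuityZ3.Theorems.Transplant.SkelPhiCellsSmallMS
import Summits.CriticalPhenomena.PercolationContinuityZ3.Theorems.Transplant.SkelPhiConcScheduleN
import Summits.CriticalPhenomena.PercolationContinuityZ3.Theorems.Transplant.SkelFrmQuasi1ParamsLF
import Summits.CriticalPhenomena.PercolationContinuityZ3.Theorems.Transplant.SkelFrmQuasi1ParamsPO
import Summits.CriticalPhenomena.PercolationContinuityZ3.Theorems.Transplant.SkelFrmQuasiBParamsLFA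
import Summits.CriticalPhenomena.PercolationContinuityZ3.Theorems.Transplant.SkelFrmQuasi1SlotTypes
import HarnessLib
import Summits.CriticalPhenomena.PercolationContinuityZ3.Theorems.Transplant.SkelFrmBChoiceDefs
/-!
# GEN-Q PORT (WAVE-Q table v0.8 section 2, row G035, U-level L7; captain R-6/R-7 2026-08-27: carrier token swap `PlanarSkeletonFrmFrom ↦ PlanarSkeletonFrmQuasi`)
# of the tree module «Transplant/SkelFrmFromBChoiceDefs» (sha256 da52d6fff265f927…) onto the quasi-step carrier `PlanarSkeletonFrmQuasi` (p507026): «SkelFrmQuasiBChoiceDefs»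

HAND HUNK (iv) (L-FLOORMAP-1 ③; p3-g30's T-variant G048 is the model): `offNS x := NrepA (cenS x) + 1 ↦ Φ.M · NrepA (cenS x) + 1` (the ×M offset floor of record of the staggered
S-scheme; its readers `offNS_le/hoffNS_at/colQ_schedOfS` are outside the used cone and not ported).

ORIGINAL TITLE: N2 (frames-only node `SamePDropOfSkeletonFrm₁`, OPEN), WAVE 1: THE CHOICE FUNCTION OF RECORD OVER `Frm` / `DataNS` / STAGGERED CELLS `PCells2S` —

builds on p205010 (kernel theorem, internal audit signed; external expert review pending) — nothing in this file uses p205010; NOTHING is claimed about any open node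
((N3-b), the end state).  Lane `prim-bschramm`, seat `prim-bschramm-stmt` (gen 33; GEN-Q column pen; tool = captain gen-1 g4's port_genq.py R-14 --cone + p3-g30's T1 patch).  Helper file (`--supports stmt-CriticalPhenomena-4575 --as helper`).
PORT RULES (U-wave r1–r4 re-used, GEN-Q hunk classes of p3-g29 #6136): declaration order, names and proof texts are those of «SkelFrmFromBChoiceDefs», byte-identical except
(i) the carrier token `PlanarSkeletonFrmFrom ↦ PlanarSkeletonFrmQuasi` in binders, `namespace`/`end` lines and qualified names (module names `SkelFrmFrom… ↦ SkelFrmQuasi…`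
in imports of already-ported rows); (ii) `Φ.step ↦ Φ.qstep` with the called Steps lemma replaced by its `…Q`/`_q` twin and the cost `Φ.M` threaded (none in this file unless
listed below); (iii) `Φ.cyl_connected ↦ Φ.cyl_reach` readers (none unless listed); (iv) graph-ball radii / window floors ×`Φ.M` (none unless listed).  Carrier-free
residents stay imported/exported from the original «SkelFrmBChoiceDefs» exactly as in the FrmFrom port.  Docstrings and citations are the original's.

-/

noncomputable section

open scoped Classical

namespace Summit.CriticalPhenomena.PercolationContinuityZ3.Theorems.Transplant

open MeasureTheory Literature.Probability.Percolation Literature.Probability.LatticeModels SimpleGraph KNCells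
open Literature.Barriers.CriticalPhenomena (HasExponentialGrowth)

namespace PlanarSkeletonFrmQuasi

open SkelConc (Consts)
open BoxProdZ2 (ConcRadiiG)
open Skelφ (oriφ trφ)
open Skelφ.StepI (DataN DataNS OutNS)

namespace NegB

open Neg

/-! ## §1 The creep slot and the staggered cells of record -/

/-- **A creep slot over `Frm`**: the creep per axis, in fine cells, as a function of everything p-fixed (constants, skeleton, base vertex, density, merged record WITH
selectors, box and width values). [this work] -/
def CSlot : Type 1 :=
  ∀ (κ : Consts) {V : Type} [DecidableEq V] [Countable V] {G : SimpleGraph V} [G.LocallyFinite],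
    PlanarSkeletonFrmQuasi G → V → unitInterval → Skelφ.StepI.DataNS V → ℕ → ℕ → Fin 2 → ℕ

-- GEN-Q (R-2, captain 2026-08-27): `PlanarSkeletonFrmFrom.NegB.CSlot.zero` is not in the used cone of the node top — not ported.

/-- **An arrival-box slot over `Frm`**: the arrival half-widths per axis, in fine cells (the K-G corridor's last core must sit inside `Mb b (x+du)` about `cenS (x+du)`;
ledger rows `10·u_i ≤ b_i ≤ 3·r_i`), as a function of the same data as the creep. [this work] -/
def BSlot : Type 1 :=
  ∀ (κ : Consts) {V : Type} [DecidableEq V] [Countable V] {G : SimpleGraph V} [G.LocallyFinite],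
    PlanarSkeletonFrmQuasi G → V → unitInterval → Skelφ.StepI.DataNS V → ℕ → ℕ → Fin 2 → ℕ

-- GEN-Q (R-2, captain 2026-08-27): `PlanarSkeletonFrmFrom.NegB.BSlot.quarter` is not in the used cone of the node top — not ported.

section Values

variable (κ : Consts) {V : Type} [DecidableEq V] [Countable V] {G : SimpleGraph V} [G.LocallyFinite] (Φ : PlanarSkeletonFrmQuasi G) (t : V)
  (p : unitInterval) (D : DataNS V) (g f : ℕ) (c : Fin 2 → ℕ)

/-- **The creep cap** `ccap := min (max c₀ c₁) (min r₀ r₁)` (so that `c_i ≤ ccap ≤ r_j` can be enforced by truncation). [this work] -/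
def ccap : ℕ := min (max (c 0) (c 1)) (min ((fcellsA κ Φ t p D g f).r 0) ((fcellsA κ Φ t p D g f).r 1))

/-- **The truncated creep** `cS i := min (c i) ccap`. [this work] -/
def cS (i : Fin 2) : ℕ := min (c i) (ccap κ Φ t p D g f c)

/-- `ccap ≤ r j`. [folklore] -/
theorem ccap_le_r (j : Fin 2) : ccap κ Φ t p D g f c ≤ (fcellsA κ Φ t p D g f).r j := by
  have h : ccap κ Φ t p D g f c ≤ min ((fcellsA κ Φ t p D g f).r 0) ((fcellsA κ Φ t p D g f).r 1) := min_le_right _ _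
  fin_cases j
  · exact h.trans (min_le_left _ _)
  · exact h.trans (min_le_right _ _)

/-- `cS i ≤ ccap` and `cS i ≤ c i`. [folklore] -/
theorem cS_le (i : Fin 2) : cS κ Φ t p D g f c i ≤ ccap κ Φ t p D g f c ∧ cS κ Φ t p D g f c i ≤ c i := ⟨min_le_right _ _, min_le_left _ _⟩

-- GEN-Q (R-2, captain 2026-08-27): `PlanarSkeletonFrmFrom.NegB.cS_eq` is not in the used cone of the node top — not ported.

/-- **THE STAGGERED CELLS OF RECORD OF THE N2 CHAIN** (`PCells2S`): the cells `fcellsA` of the (ζ′) chain with the (truncated) creep `cS` toward the onward quadrant and the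
creep bound `ccap` — total in the slot value `c`. [cite: KozmaNitzan2024, §4 p. 25 (the renormalised lattice)] -/
def fcellsS : PCells2S where
  toPCells2 := fcellsA κ Φ t p D g f
  c := fun i => ((cS κ Φ t p D g f c i : ℕ) : ℤ)
  cmax := ccap κ Φ t p D g f c
  hc0 := fun i => Int.natCast_nonneg _
  hcm := fun i => by exact_mod_cast (cS_le κ Φ t p D g f c i).1
  hcr := fun j => ccap_le_r κ Φ t p D g f c j

-- GEN-Q (R-2, captain 2026-08-27): `PlanarSkeletonFrmFrom.NegB.fcellsS_toPCells2` is not in the used cone of the node top — not ported.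

-- GEN-Q (R-2, captain 2026-08-27): `PlanarSkeletonFrmFrom.NegB.fcellsS_r` is not in the used cone of the node top — not ported.

-- GEN-Q (R-2, captain 2026-08-27): `PlanarSkeletonFrmFrom.NegB.fcellsS_s` is not in the used cone of the node top — not ported.

-- GEN-Q (R-2, captain 2026-08-27): `PlanarSkeletonFrmFrom.NegB.fcellsS_K` is not in the used cone of the node top — not ported.

-- GEN-Q (R-2, captain 2026-08-27): `PlanarSkeletonFrmFrom.NegB.fcellsS_c` is not in the used cone of the node top — not ported.

-- GEN-Q (R-2, captain 2026-08-27): `PlanarSkeletonFrmFrom.NegB.fcellsS_cmax` is not in the used cone of the node top — not ported.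

-- GEN-Q (R-2, captain 2026-08-27): `PlanarSkeletonFrmFrom.NegB.fcellsS_cmax_le` is not in the used cone of the node top — not ported.

-- GEN-Q (R-2, captain 2026-08-27): `PlanarSkeletonFrmFrom.NegB.fcellsS_c_le` is not in the used cone of the node top — not ported.

-- GEN-Q (R-2, captain 2026-08-27): `PlanarSkeletonFrmFrom.NegB.fcellsS_c_eq` is not in the used cone of the node top — not ported.

-- GEN-Q (R-2, captain 2026-08-27): `PlanarSkeletonFrmFrom.NegB.fcellsS_cenS_zero` is not in the used cone of the node top — not ported.

/-! ## §2 The column slot at the staggered centre, the schedule, the arrival half-widths -/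

/-- (GEN-Q hand hunk (iv), L-FLOORMAP-1 ③ — same shape as p3-g30's `offNT` in «SkelFrmQuasiBChoiceDefsT») **The column slot of record, read at the STAGGERED centre, at the
quasi-step cost**: `offNS x := Φ.M · NrepA (cenS x) + 1` (the quasi `hcolQ`/`hoffN` rows read `M·‖rep₂ (cenS x)‖₁ + 1 ≤ rQ a x` — «SkelPhiFaceRunNb2VQ» :55). [this work] -/
def offNS : Site 2 → ℕ := fun x => Φ.M * NrepA κ Φ t p D g f ((fcellsS κ Φ t p D g f c).cenS x) + 1

/-- **The radius schedule of record over the staggered cells**: `schedOfS S := Prm.schedN S fcellsA offNS` (numbers over the underlying `PCells2`; the column slot at `cenS`).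
[this work] -/
def schedOfS (S : Skelφ.Prm.SchedIn) : ConcRadiiG := Skelφ.Prm.schedN S (fcellsA κ Φ t p D g f) (offNS κ Φ t p D g f c)

-- GEN-Q (R-2, captain 2026-08-27): `PlanarSkeletonFrmFrom.NegB.schedOfS_eq` is not in the used cone of the node top — not ported.

-- GEN-Q (R-2, captain 2026-08-27): `PlanarSkeletonFrmFrom.NegB.schedOfS_WFS2` is not in the used cone of the node top — not ported.

-- GEN-Q (R-2, captain 2026-08-27): `PlanarSkeletonFrmFrom.NegB.colQ_schedOfS` is not in the used cone of the node top — not ported.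

variable (b : Fin 2 → ℕ)

/-- **THE (TRUNCATED) ARRIVAL HALF-WIDTHS** (in fine cells): `bS i := min (b i) (3·r_i)` — total in the slot value; the truncation is inactive under the ledger row
`b_i ≤ 3·r_i`. [this work] -/
def bS : Fin 2 → ℕ := fun i => min (b i) (3 * (fcellsA κ Φ t p D g f).r i)

-- GEN-Q (R-2, captain 2026-08-27): `PlanarSkeletonFrmFrom.NegB.bS_le` is not in the used cone of the node top — not ported.

-- GEN-Q (R-2, captain 2026-08-27): `PlanarSkeletonFrmFrom.NegB.bS_le_slot` is not in the used cone of the node top — not ported.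

/-- **Under the ledger row `b i ≤ 3·r i` the half-width IS the slot value.** [folklore] -/
theorem bS_eq (h : ∀ i, b i ≤ 3 * (fcellsA κ Φ t p D g f).r i) (i : Fin 2) : bS κ Φ t p D g f b i = b i := min_eq_left (h i)

/-! ## §3 The slot readings, the scheme of record, the choices, the choice function -/

variable (Pv : PSlot)

/-- **The extensible pair list**: `SMn ∪ extra`. [this work] -/
def SMnP : Finset (ℕ × ℕ) := SMn κ Φ t p D g f ∪ (Pv κ Φ t p D).1

/-- The ledger pairs are listed. [folklore] -/
theorem SMn_subset_SMnP : SMn κ Φ t p D g f ⊆ SMnP κ Φ t p D g f Pv := Finset.subset_union_left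

/-- The extra pairs are listed. [folklore] -/
theorem extra_subset_SMnP : (Pv κ Φ t p D).1 ⊆ SMnP κ Φ t p D g f Pv := Finset.subset_union_right

/-- **Pair admissibility of the extensible list.** [folklore] -/
theorem SMnP_adm_at : ∀ q ∈ SMnP κ Φ t p D g f Pv, D.M₀ ≤ q.1 ∧ D.n₁ q.1 ≤ q.2 := by
  intro q hq
  rcases Finset.mem_union.1 hq with h | h
  · exact SMn_adm_at κ Φ t p D g f q h
  · exact (Pv κ Φ t p D).2 q h

variable (O : OutNS V) (gv fv : Neg.FSlot) (Sv : SSlot) (cv : CSlot) (bv : BSlot) (q : unitInterval)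

/-- The box value at the merged record. [this work] -/
def gOf : ℕ := gv κ Φ t p O.merged

/-- The width value at the merged record. [this work] -/
def fOf : ℕ := fv κ Φ t p O.merged

/-- The creep value at the merged record (and the box/width values). [this work] -/
def cOf : Fin 2 → ℕ := cv κ Φ t p O.merged (gOf κ Φ t p O gv) (fOf κ Φ t p O fv)

/-- The arrival half-widths at the merged record, TRUNCATED at `3r` (`bS`). [this work] -/
def bOf : Fin 2 → ℕ := bS κ Φ t p O.merged (gOf κ Φ t p O gv) (fOf κ Φ t p O fv) (bv κ Φ t p O.merged (gOf κ Φ t p O gv) (fOf κ Φ t p O fv))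

-- GEN-Q (R-2, captain 2026-08-27): `PlanarSkeletonFrmFrom.NegB.bOf_le` is not in the used cone of the node top — not ported.

/-- **THE SCHEME OF RECORD OF THE N2 CHAIN at `(O, q)`**: `cellGeomSG₂bS` over the oriented (ζ′) fine map `fineOA`, the STAGGERED cells `fcellsS`, root `t`, schedule
`schedOfS (Sv …)`, arrival boxes `bOf` (slot `bv`, truncated at `3r`). [cite: KozmaNitzan2024, §4 pp. 25–27 (Q_v, M_v, E_{v,x}, H^j_{v,x})] -/
def ΓQ : CellGeom V ℕ :=
  Skelφ.cellGeomSG₂bS G (fineOA κ Φ t p O.D O.DT.toDataN O.ori (gOf κ Φ t p O gv) (fOf κ Φ t p O fv))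
    (fcellsS κ Φ t p O.merged (gOf κ Φ t p O gv) (fOf κ Φ t p O fv) (cOf κ Φ t p O gv fv cv)) t
    (schedOfS κ Φ t p O.merged (gOf κ Φ t p O gv) (fOf κ Φ t p O fv) (cOf κ Φ t p O gv fv cv)
      (Sv κ Φ t p O.merged (gOf κ Φ t p O gv) (fOf κ Φ t p O fv) q))
    (bOf κ Φ t p O gv fv bv)

/-- **The face data of the N2 chain at `(O, q)`** (`faceDataSGS` over `fineOA`/`fcellsS`/`schedOfS`). [this work] -/
def FDQ : FaceData V ℕ :=
  Skelφ.faceDataSGS G (fineOA κ Φ t p O.D O.DT.toDataN O.ori (gOf κ Φ t p O gv) (fOf κ Φ t p O fv))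
    (fcellsS κ Φ t p O.merged (gOf κ Φ t p O gv) (fOf κ Φ t p O fv) (cOf κ Φ t p O gv fv cv)) t
    (schedOfS κ Φ t p O.merged (gOf κ Φ t p O gv) (fOf κ Φ t p O fv) (cOf κ Φ t p O gv fv cv)
      (Sv κ Φ t p O.merged (gOf κ Φ t p O gv) (fOf κ Φ t p O fv) q))

/-- **The level data of the N2 chain at `O`** (`levelDataSS` over `fineOA`/`fcellsS`). [this work] -/
def LDQ : LevelData V ℕ :=
  Skelφ.levelDataSS (fineOA κ Φ t p O.D O.DT.toDataN O.ori (gOf κ Φ t p O gv) (fOf κ Φ t p O fv))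
    (fcellsS κ Φ t p O.merged (gOf κ Φ t p O gv) (fOf κ Φ t p O fv) (cOf κ Φ t p O gv fv cv))

-- GEN-Q (R-2, captain 2026-08-27): `PlanarSkeletonFrmFrom.NegB.ΓQ_root` is not in the used cone of the node top — not ported.

-- GEN-Q (R-2, captain 2026-08-27): `PlanarSkeletonFrmFrom.NegB.ΓQ_a₀` is not in the used cone of the node top — not ported.

-- GEN-Q (R-2, captain 2026-08-27): `PlanarSkeletonFrmFrom.NegB.ΓQ_K` is not in the used cone of the node top — not ported.

-- GEN-Q (R-2, captain 2026-08-27): `PlanarSkeletonFrmFrom.NegB.ΓQ_M` is not in the used cone of the node top — not ported.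

-- GEN-Q (R-2, captain 2026-08-27): `PlanarSkeletonFrmFrom.NegB.ΓQ_Q` is not in the used cone of the node top — not ported.

-- GEN-Q (R-2, captain 2026-08-27): `PlanarSkeletonFrmFrom.NegB.ΓQ_Efar` is not in the used cone of the node top — not ported.

-- GEN-Q (R-2, captain 2026-08-27): `PlanarSkeletonFrmFrom.NegB.ΓQ_anchSet` is not in the used cone of the node top — not ported.

variable (hC : Φ.CylSubcritical p)

/-- **THE N2 CHOICES at `(κ, Φ, t, p)` with the six slots** — `δI, m₀, Sz, SMn` as the record's (`SMnP` with the extra pairs), `Γ := ΓQ`, `FD := FDQ`, `LD := LDQ`.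
[cite: KozmaNitzan2024, §4 Theorem 6 (pp. 25–31)] -/
def choiceAtQ : ChoiceNQ κ Φ t p hC where
  δI := Neg.δI κ Φ
  m₀ := Neg.m₀
  Sz := fun O => Neg.Sz O.merged
  SMn := fun O => SMnP κ Φ t p O.merged (gOf κ Φ t p O gv) (fOf κ Φ t p O fv) Pv
  Γ := fun O q => ΓQ κ Φ t p O gv fv Sv cv bv q
  FD := fun O q => FDQ κ Φ t p O gv fv Sv cv q
  LD := fun O _ => LDQ κ Φ t p O gv fv cv
  δI_pos := Neg.δI_pos κ Φ
  δI_lt_one := Neg.δI_lt_one κ Φ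
  S_adm := fun O _ => ⟨Neg.Sz_adm O.merged, SMnP_adm_at κ Φ t p O.merged _ _ Pv⟩

end Values

end NegB

-- GEN-Q (R-2, captain 2026-08-27): `PlanarSkeletonFrmFrom.frmChoiceAllQ` is not in the used cone of the node top — not ported.

-- GEN-Q (R-2, captain 2026-08-27): `PlanarSkeletonFrmFrom.frmChoiceAllQ_eq` is not in the used cone of the node top — not ported.

-- GEN-Q (R-2, captain 2026-08-27): `PlanarSkeletonFrmFrom.frmChoiceAllQ_scheme` is not in the used cone of the node top — not ported.

end PlanarSkeletonFrmQuasi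

end Summit.CriticalPhenomena.PercolationContinuityZ3.Theorems.Transplant

end
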